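import Literature.Topology.FourManifolds.OrientationSign
import Mathlib.Geometry.Manifold.MFDeriv.Atlas
import Mathlib.Geometry.Manifold.ContMDiffMFDeriv
import HarnessLib

/-!
# The orientation character of a chart; moving frames along curves

Topic `Literature/Topology/FourManifolds`; companion of `OrientationSign.lean` (Hirsch,
*Differential Topology* (1976), Ch. 4 §4: an orientation of a manifold is a locally constant —
hence on connected sets constant — choice of orientations of the tangent spaces; a chart of a
connected open set is either orientation preserving or orientation reversing).  Everything here
is **proved**; it is the bookkeeping that lets one *evaluate* the orientation character
`SmoothOrientation.IsPosFrame` (positivity of a frame of `T_x M` read in the preferred chart at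
`x`) in an arbitrary chart of the `C^∞` maximal atlas, and transport it along curves:

* `Literature.Topology.FourManifolds.continuousOn_tangentCoordChange_of_continuousOn` — the
  hypothesis "the frame is continuous in charts" of
  `SmoothOrientation.isPosFrame_iff_of_isPreconnected` follows from continuity of the vectors as
  points of the tangent bundle (the trivialization at `p` *is* the reading in the chart at `p`).
* `Literature.Topology.FourManifolds.chartFrame φ x` — the coordinate frame `∂/∂u₁, …, ∂/∂uₙ`
  of a chart `φ` (model `𝓘(ℝ, E)`, boundaryless charts `M ⊇ U → E`) at `x`, i.e. the images of
  the reference basis `Module.finBasis ℝ E` under `d(φ⁻¹)`; `readFrame φ x v` — a frame read in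
  the chart, `dφ_x ∘ v`.
* `Literature.Topology.FourManifolds.SmoothOrientation.IsPosChart o φ x` — *the chart `φ` is
  positively oriented at `x`* (its coordinate frame is positive);
  `SmoothOrientation.isPosChart_iff_of_isPreconnected` — **constant on preconnected subsets of
  the chart domain** (Hirsch, Ch. 4 §4, remark after Lemma 4.1);
  `SmoothOrientation.isPosFrame_iff_isPosChart_iff` — **a frame is positive iff its reading in a
  positive chart has positive determinant** (and negative determinant in a negative chart).
* curves: `continuous_totalSpace_mfderiv` (the velocity of a `C¹` curve is a continuous point
  of the tangent bundle), and in dimension two `SmoothOrientation.isPosFrame_frame₂_iff_of_isPreconnected`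
  — **along a `C¹` curve `c` and a continuous vector field `V` with `(V ∘ c, ċ)` nowhere
  degenerate on a preconnected parameter set, the orientation character of the moving frame
  `(V (c t), ċ t)` is constant** (the form used for level curves of a Morse function on an
  oriented surface, `SaddleLevelDisconnected.lean`).

## References

* M. W. Hirsch, *Differential Topology*, GTM 33, Springer (1976), Ch. 4 §4 (orientations;
  Lemma 4.1 and the remark following it). [HirschDT1976]
* J. M. Lee, *Introduction to Smooth Manifolds*, 2nd ed. (2013), Ch. 15, Prop. 15.5–15.6
  (pointwise continuous orientations and oriented charts). [LeeSmoothManifolds2013]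
-/

open scoped Manifold ContDiff Topology
open Set Function Module Bundle

noncomputable section

namespace Literature.Topology.FourManifolds

/-! ### Readings in charts are continuous when the vectors move continuously in `TM` -/

section Reading

variable {E H : Type*} [NormedAddCommGroup E] [NormedSpace ℝ E] [TopologicalSpace H]
  {I : ModelWithCorners ℝ E H} {M : Type*} [TopologicalSpace M] [ChartedSpace H M]
  [IsManifold I 1 M]

/-- The trivialization of the tangent bundle at `p` reads a tangent vector at `z` in the chart
at `p`: its fibre component is `tangentCoordChange I z p z`. [folklore] -/
theorem trivializationAt_apply_snd (p x : M) (v : TangentSpace I x) :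
    (trivializationAt E (TangentSpace I) p ⟨x, v⟩).2 = tangentCoordChange I x p x v := rfl

/-- **Continuity of readings.**  If `y ↦ (γ y, w y)` is continuous on `S` as a map into the
tangent bundle, then the reading `y ↦ tangentCoordChange I (γ y) p (γ y) (w y)` of `w y` in the
chart at `p` is continuous on `S ∩ γ⁻¹(chart domain of p)` — the hypothesis of
`SmoothOrientation.isPosFrame_iff_of_isPreconnected`. [folklore] -/
theorem continuousOn_tangentCoordChange_of_continuousOn {Y : Type*} [TopologicalSpace Y]
    {S : Set Y} {γ : Y → M} {w : Y → E}
    (h : ContinuousOn (fun y => (⟨γ y, w y⟩ : TangentBundle I M)) S) (p : M) :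
    ContinuousOn (fun y => tangentCoordChange I (γ y) p (γ y) (w y))
      (S ∩ γ ⁻¹' (chartAt H p).source) := by
  set e := trivializationAt E (TangentSpace I) p with he
  have h1 : ContinuousOn (fun y => e ⟨γ y, w y⟩) (S ∩ γ ⁻¹' (chartAt H p).source) := by
    refine e.toPartialHomeomorph.continuousOn.comp (h.mono inter_subset_left) fun y hy => ?_
    show (⟨γ y, w y⟩ : TangentBundle I M) ∈ e.source
    rw [e.mem_source, he, TangentBundle.trivializationAt_baseSet]
    exact hy.2
  exact (continuous_snd.comp_continuousOn h1).congr fun y _ => (trivializationAt_apply_snd p _ _).symm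

/-- A frame of vectors moving continuously in `TM` is continuous in charts (the `hB` hypothesis
of `SmoothOrientation.isPosFrame_iff_of_isPreconnected`, componentwise). [folklore] -/
theorem continuousOn_tangentCoordChange_frame_of_continuousOn {Y : Type*} [TopologicalSpace Y]
    {S : Set Y} {γ : Y → M} {ι : Type*} {B : Y → ι → E}
    (h : ∀ i, ContinuousOn (fun y => (⟨γ y, B y i⟩ : TangentBundle I M)) S) (p : M) :
    ContinuousOn (fun y i => tangentCoordChange I (γ y) p (γ y) (B y i))
      (S ∩ γ ⁻¹' (chartAt H p).source) :=
  continuousOn_pi.2 fun i => continuousOn_tangentCoordChange_of_continuousOn (h i) p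

/-- The velocity of a `C¹` curve is a continuous point of the tangent bundle. [folklore] -/
theorem continuous_totalSpace_mfderiv {c : ℝ → M} (hc : ContMDiff 𝓘(ℝ, ℝ) I 1 c) :
    Continuous fun t : ℝ => (⟨c t, mfderiv 𝓘(ℝ, ℝ) I c t (1 : ℝ)⟩ : TangentBundle I M) := by
  have h1 : Continuous (tangentMap 𝓘(ℝ, ℝ) I c) := hc.continuous_tangentMap le_rfl
  have h0 : Continuous fun t : ℝ => (t, (1 : ℝ)) := continuous_id.prodMk continuous_const
  have h2 := (tangentBundleModelSpaceHomeomorph 𝓘(ℝ, ℝ)).symm.continuous.comp h0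
  exact (h1.comp h2).congr fun t => rfl

/-- A continuous vector field evaluated along a continuous curve moves continuously in `TM`. [folklore] -/
theorem continuous_totalSpace_comp {Y : Type*} [TopologicalSpace Y] {γ : Y → M}
    (hγ : Continuous γ) {V : Π x : M, TangentSpace I x}
    (hV : Continuous fun x => (⟨x, V x⟩ : TangentBundle I M)) :
    Continuous fun y => (⟨γ y, V (γ y)⟩ : TangentBundle I M) :=
  hV.comp hγ

end Reading

/-! ### The coordinate frame of a chart and its orientation character -/

section Chart

variable {E : Type*} [NormedAddCommGroup E] [NormedSpace ℝ E] [FiniteDimensional ℝ E]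
  {M : Type*} [TopologicalSpace M] [ChartedSpace E M] [IsManifold 𝓘(ℝ, E) ∞ M]

omit [FiniteDimensional ℝ E] [IsManifold 𝓘(ℝ, E) ∞ M] in
/-- A chart of the `C^∞` maximal atlas is differentiable at the points of its domain. [folklore] -/
theorem mdifferentiableAt_of_mem_maximalAtlas {φ : OpenPartialHomeomorph M E}
    (hφ : φ ∈ IsManifold.maximalAtlas 𝓘(ℝ, E) ∞ M) {x : M} (hx : x ∈ φ.source) :
    MDifferentiableAt 𝓘(ℝ, E) 𝓘(ℝ, E) φ x :=
  ((contMDiffOn_of_mem_maximalAtlas hφ).mdifferentiableOn (by simp) x hx).mdifferentiableAt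
    (φ.open_source.mem_nhds hx)

omit [FiniteDimensional ℝ E] [IsManifold 𝓘(ℝ, E) ∞ M] in
/-- The inverse of a chart of the `C^∞` maximal atlas is differentiable at the points of its
target. [folklore] -/
theorem mdifferentiableAt_symm_of_mem_maximalAtlas {φ : OpenPartialHomeomorph M E}
    (hφ : φ ∈ IsManifold.maximalAtlas 𝓘(ℝ, E) ∞ M) {y : E} (hy : y ∈ φ.target) :
    MDifferentiableAt 𝓘(ℝ, E) 𝓘(ℝ, E) φ.symm y :=
  ((contMDiffOn_symm_of_mem_maximalAtlas hφ).mdifferentiableOn (by simp) y hy).mdifferentiableAt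
    (φ.open_target.mem_nhds hy)

variable (φ : OpenPartialHomeomorph M E)

/-- The differential `dφ_x : T_x M → E` of the chart `φ`, as a map `E →L[ℝ] E` (the tangent
space being read in the preferred chart at `x`). [folklore] -/
def chartDiff (x : M) : E →L[ℝ] E := mfderiv 𝓘(ℝ, E) 𝓘(ℝ, E) φ x

/-- The differential `d(φ⁻¹)_{φ x} : E → T_x M` of the inverse chart, as a map `E →L[ℝ] E`. [folklore] -/
def chartSymmDiff (x : M) : E →L[ℝ] E := mfderiv 𝓘(ℝ, E) 𝓘(ℝ, E) φ.symm (φ x)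

variable {φ}

omit [FiniteDimensional ℝ E] [IsManifold 𝓘(ℝ, E) ∞ M] in
/-- Unfolding of `chartDiff`. [folklore] -/
theorem chartDiff_apply (x : M) (v : E) : chartDiff φ x v = mfderiv 𝓘(ℝ, E) 𝓘(ℝ, E) φ x v := rfl

omit [FiniteDimensional ℝ E] [IsManifold 𝓘(ℝ, E) ∞ M] in
/-- Unfolding of `chartSymmDiff`. [folklore] -/
theorem chartSymmDiff_apply (x : M) (v : E) :
    chartSymmDiff φ x v = mfderiv 𝓘(ℝ, E) 𝓘(ℝ, E) φ.symm (φ x) v := rfl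

omit [FiniteDimensional ℝ E] [IsManifold 𝓘(ℝ, E) ∞ M] in
/-- `d(φ⁻¹)_{φ x} ∘ dφ_x = id` for a chart of the maximal atlas. [folklore] -/
theorem chartSymmDiff_comp_chartDiff (hφ : φ ∈ IsManifold.maximalAtlas 𝓘(ℝ, E) ∞ M) {x : M}
    (hx : x ∈ φ.source) : (chartSymmDiff φ x).comp (chartDiff φ x) = ContinuousLinearMap.id ℝ E := by
  have h1 := mdifferentiableAt_of_mem_maximalAtlas hφ hx
  have h2 := mdifferentiableAt_symm_of_mem_maximalAtlas hφ (φ.map_source hx)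
  unfold chartSymmDiff chartDiff
  have h3 := (mfderiv_comp x h2 h1).symm
  have heq : (φ.symm ∘ φ) =ᶠ[𝓝 x] id := by
    filter_upwards [φ.open_source.mem_nhds hx] with z hz
    exact φ.left_inv hz
  rw [heq.mfderiv_eq, mfderiv_id] at h3
  exact h3

omit [FiniteDimensional ℝ E] [IsManifold 𝓘(ℝ, E) ∞ M] in
/-- `dφ_x ∘ d(φ⁻¹)_{φ x} = id` for a chart of the maximal atlas. [folklore] -/
theorem chartDiff_comp_chartSymmDiff (hφ : φ ∈ IsManifold.maximalAtlas 𝓘(ℝ, E) ∞ M) {x : M}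
    (hx : x ∈ φ.source) : (chartDiff φ x).comp (chartSymmDiff φ x) = ContinuousLinearMap.id ℝ E := by
  have h1 := mdifferentiableAt_of_mem_maximalAtlas hφ hx
  have h2 := mdifferentiableAt_symm_of_mem_maximalAtlas hφ (φ.map_source hx)
  have h1' : MDifferentiableAt 𝓘(ℝ, E) 𝓘(ℝ, E) φ (φ.symm (φ x)) := by rwa [φ.left_inv hx]
  unfold chartSymmDiff chartDiff
  have h3 := (mfderiv_comp (φ x) h1' h2).symm
  rw [φ.left_inv hx] at h3
  have heq : (φ ∘ φ.symm) =ᶠ[𝓝 (φ x)] id := by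
    filter_upwards [φ.open_target.mem_nhds (φ.map_source hx)] with z hz
    exact φ.right_inv hz
  rw [heq.mfderiv_eq, mfderiv_id] at h3
  exact h3

omit [FiniteDimensional ℝ E] [IsManifold 𝓘(ℝ, E) ∞ M] in
/-- `d(φ⁻¹) (dφ v) = v`. [folklore] -/
theorem chartSymmDiff_chartDiff (hφ : φ ∈ IsManifold.maximalAtlas 𝓘(ℝ, E) ∞ M) {x : M}
    (hx : x ∈ φ.source) (v : E) : chartSymmDiff φ x (chartDiff φ x v) = v := by
  have h := congrArg (fun T : E →L[ℝ] E => T v) (chartSymmDiff_comp_chartDiff hφ hx)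
  simpa using h

omit [FiniteDimensional ℝ E] [IsManifold 𝓘(ℝ, E) ∞ M] in
/-- `dφ (d(φ⁻¹) w) = w`. [folklore] -/
theorem chartDiff_chartSymmDiff (hφ : φ ∈ IsManifold.maximalAtlas 𝓘(ℝ, E) ∞ M) {x : M}
    (hx : x ∈ φ.source) (w : E) : chartDiff φ x (chartSymmDiff φ x w) = w := by
  have h := congrArg (fun T : E →L[ℝ] E => T w) (chartDiff_comp_chartSymmDiff hφ hx)
  simpa using h

omit [FiniteDimensional ℝ E] [IsManifold 𝓘(ℝ, E) ∞ M] in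
/-- The differential of the inverse chart has nonzero determinant. [folklore] -/
theorem det_chartSymmDiff_ne_zero (hφ : φ ∈ IsManifold.maximalAtlas 𝓘(ℝ, E) ∞ M) {x : M}
    (hx : x ∈ φ.source) : LinearMap.det (chartSymmDiff φ x : E →ₗ[ℝ] E) ≠ 0 := by
  have h := congrArg (fun T : E →L[ℝ] E => LinearMap.det (T : E →ₗ[ℝ] E))
    (chartSymmDiff_comp_chartDiff hφ hx)
  simp only [ContinuousLinearMap.coe_id, LinearMap.det_id] at h
  rw [show ((chartSymmDiff φ x).comp (chartDiff φ x) : E →ₗ[ℝ] E) =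
      (chartSymmDiff φ x : E →ₗ[ℝ] E).comp (chartDiff φ x : E →ₗ[ℝ] E) from rfl,
    LinearMap.det_comp] at h
  exact left_ne_zero_of_mul_eq_one h

omit [FiniteDimensional ℝ E] [IsManifold 𝓘(ℝ, E) ∞ M] in
/-- The differential of the chart has nonzero determinant. [folklore] -/
theorem det_chartDiff_ne_zero (hφ : φ ∈ IsManifold.maximalAtlas 𝓘(ℝ, E) ∞ M) {x : M}
    (hx : x ∈ φ.source) : LinearMap.det (chartDiff φ x : E →ₗ[ℝ] E) ≠ 0 := by
  have h := congrArg (fun T : E →L[ℝ] E => LinearMap.det (T : E →ₗ[ℝ] E))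
    (chartDiff_comp_chartSymmDiff hφ hx)
  simp only [ContinuousLinearMap.coe_id, LinearMap.det_id] at h
  rw [show ((chartDiff φ x).comp (chartSymmDiff φ x) : E →ₗ[ℝ] E) =
      (chartDiff φ x : E →ₗ[ℝ] E).comp (chartSymmDiff φ x : E →ₗ[ℝ] E) from rfl,
    LinearMap.det_comp] at h
  exact left_ne_zero_of_mul_eq_one h

variable (φ)

/-- **The coordinate frame of the chart `φ` at `x`**: the vectors `d(φ⁻¹)_{φ x} (bᵢ)` of
`T_x M` (read in the preferred chart at `x`), `b = Module.finBasis ℝ E` the reference basis of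
`SmoothOrientation.IsPosFrame` (Lee 2013, Ch. 15: the coordinate frame `∂/∂xⁱ` of a chart). [cite: LeeSmoothManifolds2013, Ch. 15 (oriented charts, Prop. 15.6)] -/
def chartFrame (x : M) : Fin (finrank ℝ E) → E :=
  fun i => chartSymmDiff φ x (finBasis ℝ E i)

/-- **A frame read in the chart `φ`**: `dφ_x ∘ v`. [cite: LeeSmoothManifolds2013, Ch. 15 (oriented charts)] -/
def readFrame {ι : Type*} (x : M) (v : ι → E) : ι → E :=
  fun i => chartDiff φ x (v i)

variable {φ}

omit [FiniteDimensional ℝ E] [IsManifold 𝓘(ℝ, E) ∞ M] in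
/-- Unfolding of `readFrame`. [folklore] -/
@[simp] theorem readFrame_apply {ι : Type*} (x : M) (v : ι → E) (i : ι) :
    readFrame φ x v i = mfderiv 𝓘(ℝ, E) 𝓘(ℝ, E) φ x (v i) := rfl

omit [IsManifold 𝓘(ℝ, E) ∞ M] in
/-- Unfolding of `chartFrame`. [folklore] -/
theorem chartFrame_apply (x : M) (i : Fin (finrank ℝ E)) :
    chartFrame φ x i = mfderiv 𝓘(ℝ, E) 𝓘(ℝ, E) φ.symm (φ x) (finBasis ℝ E i) := rfl

omit [FiniteDimensional ℝ E] [IsManifold 𝓘(ℝ, E) ∞ M] in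
/-- A frame is recovered from its reading by `d(φ⁻¹)`. [folklore] -/
theorem chartSymmDiff_readFrame (hφ : φ ∈ IsManifold.maximalAtlas 𝓘(ℝ, E) ∞ M) {x : M}
    (hx : x ∈ φ.source) {ι : Type*} (v : ι → E) (i : ι) :
    chartSymmDiff φ x (readFrame φ x v i) = v i :=
  chartSymmDiff_chartDiff hφ hx (v i)

omit [IsManifold 𝓘(ℝ, E) ∞ M] in
/-- **Determinant of a frame through its reading**:
`det_b v = det d(φ⁻¹)_{φ x} · det_b (dφ_x ∘ v)`. [folklore] -/
theorem det_eq_det_chartSymmDiff_mul_det_readFrame (hφ : φ ∈ IsManifold.maximalAtlas 𝓘(ℝ, E) ∞ M)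
    {x : M} (hx : x ∈ φ.source) (v : Fin (finrank ℝ E) → E) :
    (finBasis ℝ E).det v =
      LinearMap.det (chartSymmDiff φ x : E →ₗ[ℝ] E) * (finBasis ℝ E).det (readFrame φ x v) := by
  rw [← basis_det_clm_apply]
  congr 1
  funext i
  exact (chartSymmDiff_readFrame hφ hx v i).symm

omit [IsManifold 𝓘(ℝ, E) ∞ M] in
/-- The determinant of the coordinate frame is the determinant of `d(φ⁻¹)`. [folklore] -/
theorem det_chartFrame (x : M) :
    (finBasis ℝ E).det (chartFrame φ x) = LinearMap.det (chartSymmDiff φ x : E →ₗ[ℝ] E) := by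
  unfold chartFrame
  rw [basis_det_clm_apply, Basis.det_self, mul_one]

omit [IsManifold 𝓘(ℝ, E) ∞ M] in
/-- The coordinate frame of a chart of the maximal atlas is non-degenerate. [folklore] -/
theorem det_chartFrame_ne_zero (hφ : φ ∈ IsManifold.maximalAtlas 𝓘(ℝ, E) ∞ M) {x : M}
    (hx : x ∈ φ.source) : (finBasis ℝ E).det (chartFrame φ x) ≠ 0 := by
  rw [det_chartFrame]
  exact det_chartSymmDiff_ne_zero hφ hx

/-- **The coordinate frame moves continuously in `TM`** over the chart domain (the inverse
chart is `C^∞`, so its tangent map is continuous). [folklore] -/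
theorem continuousOn_totalSpace_chartFrame (hφ : φ ∈ IsManifold.maximalAtlas 𝓘(ℝ, E) ∞ M)
    (i : Fin (finrank ℝ E)) :
    ContinuousOn (fun x => (⟨x, (chartFrame φ x i : E)⟩ : TangentBundle 𝓘(ℝ, E) M)) φ.source := by
  -- the tangent map of `φ.symm` on its (open) target
  have h1 : ContinuousOn (tangentMapWithin 𝓘(ℝ, E) 𝓘(ℝ, E) φ.symm φ.target)
      (π E (TangentSpace 𝓘(ℝ, E)) ⁻¹' φ.target) :=
    (contMDiffOn_symm_of_mem_maximalAtlas hφ).continuousOn_tangentMapWithin (by simp)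
      φ.open_target.uniqueMDiffOn
  -- the section `y ↦ (φ y, bᵢ)` of the tangent bundle of the model space
  have h0 : ContinuousOn (fun x : M => (φ x, finBasis ℝ E i)) φ.source :=
    φ.continuousOn.prodMk continuousOn_const
  have h2 := (tangentBundleModelSpaceHomeomorph 𝓘(ℝ, E)).symm.continuous.comp_continuousOn h0
  have h3 := h1.comp h2 fun x hx => by
    show φ x ∈ φ.target
    exact φ.map_source hx
  refine h3.congr fun x hx => ?_
  show (⟨x, (chartFrame φ x i : E)⟩ : TangentBundle 𝓘(ℝ, E) M) =
    tangentMapWithin 𝓘(ℝ, E) 𝓘(ℝ, E) φ.symm φ.target ⟨φ x, finBasis ℝ E i⟩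
  rw [tangentMapWithin, mfderivWithin_of_isOpen φ.open_target (φ.map_source hx)]
  rw [chartFrame_apply]
  exact (congrArg (fun y : M => (⟨y, mfderiv 𝓘(ℝ, E) 𝓘(ℝ, E) φ.symm (φ x) (finBasis ℝ E i)⟩ :
    TangentBundle 𝓘(ℝ, E) M)) (φ.left_inv hx)).symm

namespace SmoothOrientation

variable (o : SmoothOrientation 𝓘(ℝ, E) M)

/-- **The chart `φ` is positively oriented at `x`** (for the orientation `o`): its coordinate
frame at `x` is a positive frame (Lee 2013, Ch. 15: "positively oriented chart"; Hirsch 1976,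
Ch. 4 §4). [cite: LeeSmoothManifolds2013, Ch. 15 (Prop. 15.6)] -/
def IsPosChart (φ : OpenPartialHomeomorph M E) (x : M) : Prop :=
  o.IsPosFrame x (chartFrame φ x)

variable {o}

/-- **The orientation character of a chart is constant on preconnected subsets of its domain**
(Hirsch 1976, Ch. 4 §4: a diffeomorphism of connected oriented manifolds preserves or reverses
orientation; "to determine which one, it suffices to see whether a single `T_x f` preserves
orientation"). [cite: HirschDT1976, Ch. 4 §4 (after Lemma 4.1)] -/
theorem isPosChart_iff_of_isPreconnected (o : SmoothOrientation 𝓘(ℝ, E) M)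
    (hφ : φ ∈ IsManifold.maximalAtlas 𝓘(ℝ, E) ∞ M) {C : Set M} (hC : IsPreconnected C)
    (hCφ : C ⊆ φ.source) {x x' : M} (hx : x ∈ C) (hx' : x' ∈ C) :
    o.IsPosChart φ x ↔ o.IsPosChart φ x' := by
  unfold IsPosChart
  exact o.isPosFrame_iff_of_isPreconnected hC (γ := id) (B := chartFrame φ)
    continuousOn_id
    (fun p => continuousOn_tangentCoordChange_frame_of_continuousOn (γ := id)
      (fun i => (continuousOn_totalSpace_chartFrame hφ i).mono hCφ) p)
    (fun y hy => det_chartFrame_ne_zero hφ (hCφ hy)) hx hx'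

/-- **Positivity of a frame through a chart.**  For a non-degenerate frame `v` of `T_x M`, `x`
in the domain of the chart `φ`: `v` is positive iff (the chart is positive at `x` iff the
reading `dφ_x ∘ v` has positive determinant).  In a positive chart: positive frames are those
whose coordinate matrix has positive determinant (Lee 2013, Prop. 15.6). [cite: LeeSmoothManifolds2013, Ch. 15 (Prop. 15.6)] -/
theorem isPosFrame_iff_isPosChart_iff (o : SmoothOrientation 𝓘(ℝ, E) M)
    (hφ : φ ∈ IsManifold.maximalAtlas 𝓘(ℝ, E) ∞ M) {x : M} (hx : x ∈ φ.source)
    {v : Fin (finrank ℝ E) → E} (hv : (finBasis ℝ E).det (readFrame φ x v) ≠ 0) :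
    o.IsPosFrame x v ↔ (o.IsPosChart φ x ↔ 0 < (finBasis ℝ E).det (readFrame φ x v)) := by
  unfold IsPosChart SmoothOrientation.IsPosFrame
  rw [det_eq_det_chartSymmDiff_mul_det_readFrame hφ hx v, det_chartFrame, ← mul_assoc]
  exact mul_pos_iff_pos_iff_pos (mul_ne_zero (o.sign_ne_zero x)
    (det_chartSymmDiff_ne_zero hφ hx)) hv

/-- **Comparison of two frames at two points of a preconnected part of a chart domain**: they
have the same orientation character iff their readings have determinants of the same sign. [cite: HirschDT1976, Ch. 4 §4 (after Lemma 4.1)] -/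
theorem isPosFrame_iff_isPosFrame_iff_det_readFrame (o : SmoothOrientation 𝓘(ℝ, E) M)
    (hφ : φ ∈ IsManifold.maximalAtlas 𝓘(ℝ, E) ∞ M) {C : Set M} (hC : IsPreconnected C)
    (hCφ : C ⊆ φ.source) {x x' : M} (hx : x ∈ C) (hx' : x' ∈ C)
    {v v' : Fin (finrank ℝ E) → E} (hv : (finBasis ℝ E).det (readFrame φ x v) ≠ 0)
    (hv' : (finBasis ℝ E).det (readFrame φ x' v') ≠ 0) :
    (o.IsPosFrame x v ↔ o.IsPosFrame x' v') ↔
      (0 < (finBasis ℝ E).det (readFrame φ x v) ↔ 0 < (finBasis ℝ E).det (readFrame φ x' v')) := by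
  rw [o.isPosFrame_iff_isPosChart_iff hφ (hCφ hx) hv, o.isPosFrame_iff_isPosChart_iff hφ (hCφ hx') hv',
    o.isPosChart_iff_of_isPreconnected hφ hC hCφ hx hx']
  tauto

end SmoothOrientation

end Chart

/-! ### Dimension two: moving frames `(V, ċ)` along curves -/

section Two

variable {E : Type*} [NormedAddCommGroup E] [NormedSpace ℝ E] [FiniteDimensional ℝ E]

/-- The frame `(u, v)` of a plane `E` (`finrank ℝ E = 2`), indexed by `Fin (finrank ℝ E)` as
`SmoothOrientation.IsPosFrame` requires: index `0 ↦ u`, the other index `↦ v`. [folklore] -/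
def frame₂ (u v : E) : Fin (finrank ℝ E) → E := fun i => if (i : ℕ) = 0 then u else v

omit [FiniteDimensional ℝ E] in
/-- Component `0` of `frame₂`. [folklore] -/
@[simp] theorem frame₂_apply_of_eq_zero (u v : E) {i : Fin (finrank ℝ E)} (hi : (i : ℕ) = 0) :
    frame₂ u v i = u := by simp [frame₂, hi]

omit [FiniteDimensional ℝ E] in
/-- The other component of `frame₂`. [folklore] -/
@[simp] theorem frame₂_apply_of_ne_zero (u v : E) {i : Fin (finrank ℝ E)} (hi : (i : ℕ) ≠ 0) :
    frame₂ u v i = v := by simp [frame₂, hi]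

omit [FiniteDimensional ℝ E] in
/-- A linear map acts on `frame₂` componentwise. [folklore] -/
theorem map_frame₂ (T : E →L[ℝ] E) (u v : E) :
    (fun i => T (frame₂ u v i)) = frame₂ (T u) (T v) := by
  funext i
  by_cases hi : (i : ℕ) = 0 <;> simp [frame₂, hi]

variable {H : Type*} [TopologicalSpace H] {I : ModelWithCorners ℝ E H}
  {M : Type*} [TopologicalSpace M] [ChartedSpace H M] [IsManifold I 1 M]

/-- **The orientation character of a moving frame `(V (c t), ċ t)` along a `C¹` curve is
constant on preconnected parameter sets where the frame is non-degenerate** (`V` a continuous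
vector field; Hirsch 1976, Ch. 4 §4). [cite: HirschDT1976, Ch. 4 §4] -/
theorem SmoothOrientation.isPosFrame_frame₂_iff_of_isPreconnected (o : SmoothOrientation I M)
    {c : ℝ → M} (hc : ContMDiff 𝓘(ℝ, ℝ) I 1 c) {V : Π x : M, TangentSpace I x}
    (hV : Continuous fun x => (⟨x, V x⟩ : TangentBundle I M)) {S : Set ℝ} (hS : IsPreconnected S)
    (hdet : ∀ t ∈ S, (finBasis ℝ E).det (frame₂ (V (c t)) (mfderiv 𝓘(ℝ, ℝ) I c t (1 : ℝ))) ≠ 0)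
    {t t' : ℝ} (ht : t ∈ S) (ht' : t' ∈ S) :
    o.IsPosFrame (c t) (frame₂ (V (c t)) (mfderiv 𝓘(ℝ, ℝ) I c t (1 : ℝ))) ↔
      o.IsPosFrame (c t') (frame₂ (V (c t')) (mfderiv 𝓘(ℝ, ℝ) I c t' (1 : ℝ))) := by
  refine o.isPosFrame_iff_of_isPreconnected hS (γ := c)
    (B := fun t => frame₂ (V (c t)) (mfderiv 𝓘(ℝ, ℝ) I c t (1 : ℝ))) hc.continuous.continuousOn
    (fun p => ?_) hdet ht ht'
  refine continuousOn_tangentCoordChange_frame_of_continuousOn (fun i => ?_) p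
  by_cases hi : (i : ℕ) = 0
  · simp only [frame₂_apply_of_eq_zero _ _ hi]
    exact (continuous_totalSpace_comp hc.continuous hV).continuousOn
  · simp only [frame₂_apply_of_ne_zero _ _ hi]
    exact (continuous_totalSpace_mfderiv hc).continuousOn

end Two

end Literature.Topology.FourManifolds
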